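import Summits.AtomisticToContinuum.HydrodynamicLimit.Theses.JParityClosure
import Summits.AtomisticToContinuum.HydrodynamicLimit.Theorems.JParityClosureAssemblyEnergyOneSided
import Summits.AtomisticToContinuum.HydrodynamicLimit.Theorems.JParityClosureParityBandClosureCoarseEntropy
import Summits.AtomisticToContinuum.HydrodynamicLimit.Theorems.JParityClosureParityBandClosureMomentumAtInstant
import Summits.AtomisticToContinuum.HydrodynamicLimit.Theorems.JParityClosureParityBandClosureEnergyFloor
import Summits.AtomisticToContinuum.HydrodynamicLimit.Theorems.JParityClosureParityBandClosureEntropyNoDipAtOfHydrodynamicLimit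
import Summits.AtomisticToContinuum.HydrodynamicLimit.Theorems.JParityClosureParityInBandDensity
import HarnessLib

/-!
# Line `split-mcta-entropy-floor` — crux `JParityClosure.ParityBandClosure` (stmt-AtomisticToContinuum-17608), ALTERNATIVE
# line (crux-strategist s1, 2026-08-17): the ROUTE-LEVEL SPLIT in skeleton form — two stubs, nothing else

THE CRUX. `ParityBandClosure := OddContactSymmetry → EvenStressEnskog → RateFloor → LocalSecondLaw → DensityCap →
_root_.HydrodynamicLimit` (closure step of route JParityClosure).

THE LINE. It is the lead's line `entropy-floor-fixes-energy` (skeleton v3.2, `Lines/entropy_floor_fixes_energy.lean`) with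
(i) its three LANDED own stubs cited as theorems (`stub_momentumAtInstant` p149671, `stub_coarseEntropyIntegrable` p148638,
`stub_energyFloorOfEntropyFloor` p151116 — used by name below, not re-proved) and (ii) its whole UPSTREAM bundle —
`stub_kineticEnergyTails` (13087) ∘ `stub_kineticHalf` (DEAD AS TYPED: `OddContactSymmetry → RateFloor → LocalSecondLaw →
DensityCap → KineticEnergyTails → WeakStressIsotropyInBand` over the un-restated decls 17722/13080, `Lines/SketchDead.md`,
Negative/YoungMixingObstruction p141493) ∘ `stub_gronwallInputs` (13354 ∧ 13481 ∧ 13352) ∘ the proved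
`windowClosure_of_weakStressIsotropy` — replaced by ONE stub typed as its honest OUTPUT, the unconditional waypoint
`MollifiedCloseTimeAveraged` (time-averaged `L¹` closure of the `r`-mollified fields in the guarded frame). So the skeleton has
exactly the two stubs of the strategist's typed split (`Cruxes/ParityBandClosure/Split.lean`, theorem
`ParityBandClosureSplit.parityBandClosure_of_subs`, rc 0, 0 sorry — the glue of the route-level split
`ParityBandClosure ⇐ MollifiedCloseTimeAveraged ∧ EntropyNoDipAt`, to be filed by `route edit --split` on a final cycle):

* `stub_mollifiedCloseTimeAveraged : MollifiedCloseTimeAveraged` (XL — the bulk: kinetic half + pressure value + relative-energy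
  Grönwall; EVERY input is admissible because the stub is a plain statement about the dynamics, not an implication over the
  weak decls: the restated kinetic inputs `SketchRepair.OddContactSymmetryJump` / `PointwiseRateFloor` as hypotheses of
  `--supports` helpers, the landed measure-level chain p139072/p138663/p141247/p139366/p137939/p137300, the landed pressure value
  p136561, the sister's landed BF18 shell p136414 + kinetic reduction p138091 with 13354/13481/13352 by name, or the plain-13081
  shell of line `plain-entropy-finite-n-bf`);
* `stub_entropyNoDipAt : EntropyNoDipAt` (L–XL — the one new dynamical input, fixed-time local entropy floor; NECESSARY:
  `_root_.HydrodynamicLimit → EntropyNoDipAt` is LANDED p151101 and re-exported below; rung 0 static, `t = 0` by the LLN).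

WHY IT DODGES THE STUCK GOALS OF THE LIVE LINE. The live skeleton's four open stubs are all BLOCKED ON INPUTS, and one of them,
`stub_kineticHalf`, is unprovable AS TYPED until the tenure planner restates 17722/13080 (R-a/R-b) — a line with a dead-typed
stub can never close. Here no stub is typed over the weak decls: `stub_mollifiedCloseTimeAveraged` is a statement about the
dynamics that can absorb the restated kinetic half as soon as anyone proves it under ANY admissible hypotheses;
`stub_entropyNoDipAt` is unchanged (it IS the lead's own hardest stub). `stub_kineticEnergyTails` and `stub_gronwallInputs`
disappear from the stub list (they are inputs of a proof of MCTA, consumed inside it, never at the instant). The readout needs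
NO velocity moment beyond the conserved energy (grep: no `KineticEnergyTails`, `EnergyCurrentTails`, `CollisionRate`,
`LimitCollisionMeasure` below the module docstring).

`ParityBandClosure_of : JParityClosure.ParityBandClosure` concludes the crux BY NAME from the two stubs (used by name) and
LANDED theorems only; its only axioms beyond the standard three are the two stubs' `sorryAx`.

DISPROOF USED (`Cruxes/ParityBandClosure/Disproof.lean`, cycle 1, NO KILL): §1 anatomy — neither stub restates or weakens the
crux / the Statement (BC7 probe of both, as route-context defs, VERDICT CLEAN: `C → S` and `S → C` batteries fail;
`scratch_children_probe.lean` in the strategist folder); §2 no `_false_without_<H>` exists (summit-hard both ways) — this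
skeleton consumes `EvenStressEnskog` + `DensityCap` at the instant, the other three hypotheses inside any proof of MCTA;
§3 unguarded-`DensityCap` vacuity channel — both waypoints are typed in the GUARDED frame (`∃ η₀`, `ρσ³ < η₀`), no implosion
exposure added; §5 engine hazards (G2 `not_isEntropyCutoff_id`) live inside `stub_mollifiedCloseTimeAveraged` only; §6 junk
audit — Bochner junk of the dip event handled by the landed `CoarseEntropyIntegrable` inside the consumer; landed Negative
lemmas `Negative/Anatomy` (p134074), `Negative/YoungMixingObstruction` (p141493) bear on the kinetic half only and no stub here
is an instance (MCTA is unconditional; the obstruction kills black-box PROOFS from 17722/13080 as typed, not the statement).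
-/

noncomputable section

namespace Summit.AtomisticToContinuum.HydrodynamicLimit.Cruxes.ParityBandClosure.SplitMctaEntropyFloor

open scoped BigOperators Topology Classical MeasureTheory ENNReal InnerProductSpace
open Filter Set MeasureTheory
open Literature.MathematicalPhysics.KineticTheory
open Literature.Analysis.FluidPDE
open Summit.AtomisticToContinuum.HydrodynamicLimit.Theses

/-! ## §1 Typed waypoints (VERBATIM those of `Lines/entropy_floor_fixes_energy.lean`) -/

/-- **Mollified fields close in TIME AVERAGE** (VERBATIM the waypoint of `Lines/entropy_floor_fixes_energy.lean`, of
`Lines/plain_entropy_finite_n_bf.lean`, `Lines/transfer_weighted_parity_chain.lean`, the dead `Lines/Sketch.lean` and the sister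
`Cruxes/ChaosClosesEuler/Lines/Sketch.lean`; child 1 of the strategist's split): in the guarded frame, for every
`t < t + Δ < T`, the window integral of the three `L¹(dx)` errors of the `r`-cone-mollified empirical density / momentum / energy
against the classical fields exceeds `ηΔ` with small probability (`N → ∞` at fixed `r < r₀(η,δ)`). -/
def MollifiedCloseTimeAveraged : Prop :=
  ∃ η₀ : ℝ, 0 < η₀ ∧ ∀ (a₀ θ₀ : T3 → ℝ) (u₀ : T3 → V3), Continuous a₀ → Continuous θ₀ → Continuous u₀ →
    (∀ x, 0 < a₀ x) → (∀ x, 0 < θ₀ x) → ∃ σ₀ : ℝ, 0 < σ₀ ∧ ∀ σ : ℝ, 0 < σ → σ < σ₀ →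
    ∀ (T : ℝ) (ρ θ : ℝ → T3 → ℝ) (u : ℝ → T3 → V3), IsHardSphereEulerSolution σ T ρ u θ →
    (∀ t ∈ Set.Ico 0 T, ∀ x, ρ t x * σ ^ 3 < η₀) →
    ∀ Φ : (N : ℕ) → HardSphereFlow (Torus.geometry (Fin 3)) (hsDiameter σ N) (N + 1),
    TendstoHydroFieldsAt (fun N => localGibbsLaw σ a₀ u₀ θ₀ N (Φ N)) Φ ρ u θ 0 →
    ∀ t ∈ Set.Ico 0 T, ∀ Δ : ℝ, 0 < Δ → t + Δ < T → ∀ η δ : ℝ, 0 < η → 0 < δ →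
    ∃ r₀ : ℝ, 0 < r₀ ∧ ∀ r : ℝ, 0 < r → r < r₀ → ∃ N₀ : ℕ, ∀ N : ℕ, N₀ ≤ N →
    let bx : T3 → T3 → ℝ := fun y x => 3 / (Real.pi * r ^ 3) * max (1 - Torus.euclidDist y x / r) 0
    localGibbsLaw σ a₀ u₀ θ₀ N (Φ N)
        {z | η * Δ < ∫ s in Set.Icc t (t + Δ),
          ((∫ x, |empiricalDensityField ((Φ N).flow s z) (fun y => bx y x) - ρ s x|)
          + (∫ x, ‖empiricalMomentumField ((Φ N).flow s z) (fun y => bx y x) - ρ s x • u s x‖)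
          + ∫ x, |empiricalEnergyField ((Φ N).flow s z) (fun y => bx y x) -
              totalEnergyDensity (ρ s x) (u s x) (θ s x)|)} ≤ ENNReal.ofReal δ

/-- **FIXED-TIME LOCAL ENTROPY FLOOR** (`EntropyNoDipAt`; VERBATIM the waypoint of `Lines/entropy_floor_fixes_energy.lean`
and the def of the landed anatomy file `ParityBandClosureEntropyNoDipAtAnatomy`; child 2 of the strategist's split): at a fixed
`t ∈ [0,T)`, for every continuous `ψ ≥ 0`, the `ψ·θ(t,·)`-weighted hard-sphere field entropy of the `r`-cone-mollified empirical
fields is, with local-Gibbs probability `≥ 1 − δ`, not more than `η` BELOW its classical value; `Hs`, `ρm`, `mm`, `em`, `θm`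
EXACTLY as in `JParityClosure.LocalSecondLaw` (13081). -/
def EntropyNoDipAt : Prop :=
  ∃ η₀ : ℝ, 0 < η₀ ∧ ∀ (a₀ θ₀ : T3 → ℝ) (u₀ : T3 → V3), Continuous a₀ → Continuous θ₀ → Continuous u₀ →
    (∀ x, 0 < a₀ x) → (∀ x, 0 < θ₀ x) → ∃ σ₀ : ℝ, 0 < σ₀ ∧ ∀ σ : ℝ, 0 < σ → σ < σ₀ →
    ∀ (T : ℝ) (ρ θ : ℝ → T3 → ℝ) (u : ℝ → T3 → V3), IsHardSphereEulerSolution σ T ρ u θ →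
    (∀ t ∈ Set.Ico 0 T, ∀ x, ρ t x * σ ^ 3 < η₀) →
    ∀ Φ : (N : ℕ) → HardSphereFlow (Torus.geometry (Fin 3)) (hsDiameter σ N) (N + 1),
    TendstoHydroFieldsAt (fun N => localGibbsLaw σ a₀ u₀ θ₀ N (Φ N)) Φ ρ u θ 0 →
    ∀ t ∈ Set.Ico 0 T, ∀ ψ : T3 → ℝ, Continuous ψ → (∀ x, 0 ≤ ψ x) → ∀ η δ : ℝ, 0 < η → 0 < δ →
    ∃ r₀ : ℝ, 0 < r₀ ∧ ∀ r : ℝ, 0 < r → r < r₀ → ∃ N₀ : ℕ, ∀ N : ℕ, N₀ ≤ N →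
    let bx : T3 → T3 → ℝ := fun x y => 3 / (Real.pi * r ^ 3) * max (1 - Torus.euclidDist x y / r) 0
    let ρm : Config (N + 1) (Fin 3) T3 → T3 → ℝ := fun w x₀ => ∫ q, bx q.1 x₀ ∂(empiricalMeasure w)
    let mm : Config (N + 1) (Fin 3) T3 → T3 → V3 := fun w x₀ => ∫ q, bx q.1 x₀ • q.2 ∂(empiricalMeasure w)
    let em : Config (N + 1) (Fin 3) T3 → T3 → ℝ := fun w x₀ =>
      ∫ q, bx q.1 x₀ * (‖q.2‖ ^ 2 / 2) ∂(empiricalMeasure w)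
    let θm : Config (N + 1) (Fin 3) T3 → T3 → ℝ := fun w x₀ =>
      2 / 3 * (em w x₀ / ρm w x₀ - ‖mm w x₀‖ ^ 2 / (2 * ρm w x₀ ^ 2))
    let Hs : ℝ → ℝ → ℝ := fun a b =>
      if 0 < a ∧ 0 < b then -(a * (3 / 2 * Real.log b - Real.log a - hsExcessFreeEnergy (a * σ ^ 3))) else 0
    localGibbsLaw σ a₀ u₀ θ₀ N (Φ N)
      {z | (∫ x : T3, ψ x * θ t x *
          (Hs (ρ t x) (θ t x) - Hs (ρm ((Φ N).flow t z) x) (θm ((Φ N).flow t z) x))) < -η} ≤ ENNReal.ofReal δ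

/-! ## §2 The two stubs -/

/-- STUB (XL, THE BULK; child 1 of the route-level split): **the time-averaged closure of the mollified fields.** Intended
proof inside this route = the lead's `windowClosure_of_stubs` with its kinetic half RESTATED (R-a jump-marked odd marks,
consumer landed p141247; R-b scale-`r` rate floor): kinetic half ⇒ `WeakStressIsotropyInBand` ⇒ pressure value (p136561) ⇒
relative-energy Grönwall (sister's landed BF18 shell p136414 + kinetic reduction p138091 fed with 13354 ∧ 13481 ∧ clamped
13352 — `windowClosure_of_weakStressIsotropy`, proved in the live skeleton — or the plain-13081 shell of line
`plain-entropy-finite-n-bf`). A seat handed this stub may land ANY of those pieces as `--supports stmt-17608` helpers with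
explicit hypotheses; the stub itself closes when the inputs are items/theorems. Why it might fail: it is the bulk of the
hydrodynamic limit (recollision memory over `N^{1/3}` mean free times; the kinetic half is open physics). -/
theorem stub_mollifiedCloseTimeAveraged : MollifiedCloseTimeAveraged := by
  sorry

/-- ANATOMY (LANDED p151101): the summit conjunct implies the floor — `stub_entropyNoDipAt` is a NECESSARY input. -/
theorem entropyNoDipAt_of_hydrodynamicLimit : _root_.HydrodynamicLimit → EntropyNoDipAt :=
  Summit.AtomisticToContinuum.HydrodynamicLimit.Theorems.ParityBandClosureEntropyNoDipAtAnatomy.stub_entropyNoDipAtOfHydrodynamicLimit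

/-- STUB (L–XL, THE NEW INPUT; child 2 of the route-level split; IDENTICAL to the live line's `stub_entropyNoDipAt`): **the
fixed-time local entropy floor.** Ways in: (i) `LocalSecondLawAt` (13081 with the boundary term at `τ = t`, planner-typed
`lsl-at.lean`) + `MollifiedCloseTimeAveraged` + UI of the entropy flux on cold-fast cells (`ColdCrossBound` proved); (ii) direct
fixed-instant relative entropy. Rung 0 static (Gibbs invariance p72343 + fixed-`r` LLN); `t = 0` from the LLN + Jensen. Why it
might fail: an `O(1)` mass of ultra-cold sub-`r` cells at one instant fed by entropy-RAISING anomalous conduction (barrier note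
B2) is invisible to time-integrated hypotheses and to entropy/LD transfer (B1). -/
theorem stub_entropyNoDipAt : EntropyNoDipAt := by
  sorry

/-! ## §3 The composition (no `sorry` of its own; literally `ParityBandClosureSplit.parityBandClosure_of_subs` of
`Cruxes/ParityBandClosure/Split.lean` fed with the two stubs) -/

/-- **The line closes the crux modulo its two stubs**: the crux BY NAME from `stub_mollifiedCloseTimeAveraged`,
`stub_entropyNoDipAt` (used by name) and LANDED theorems only — momentum third `ParityBandClosureMomentumAtInstant.stub_momentumAtInstant`
(p149671), energy third `ParityBandClosureEnergyFloor.stub_energyFloorOfEntropyFloor` (p151116) fed with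
`ParityBandClosureCoarseEntropy.stub_coarseEntropyIntegrable` (p148638) and `Theorems.energyConjunct_of_lower`, density third
`ParityInBandDensity.parityInBand_densityField_of_densityCap`; consumed at the instant: `EvenStressEnskog`, `DensityCap`. -/
theorem ParityBandClosure_of :
    Summit.AtomisticToContinuum.HydrodynamicLimit.Theses.JParityClosure.ParityBandClosure := by
  have hM : MollifiedCloseTimeAveraged := stub_mollifiedCloseTimeAveraged
  have hEnt : EntropyNoDipAt := stub_entropyNoDipAt
  intro hO hE hR hL hD
  have hMom := Summit.AtomisticToContinuum.HydrodynamicLimit.Theorems.ParityBandClosureMomentumAtInstant.stub_momentumAtInstant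
    hM hE hD
  have hEn := Summit.AtomisticToContinuum.HydrodynamicLimit.Theorems.ParityBandClosureEnergyFloor.stub_energyFloorOfEntropyFloor
    Summit.AtomisticToContinuum.HydrodynamicLimit.Theorems.ParityBandClosureCoarseEntropy.stub_coarseEntropyIntegrable
    hEnt hD hMom
  obtain ⟨η₁, hη₁, H₁⟩ := hMom
  obtain ⟨η₂, hη₂, H₂⟩ := hEn
  obtain ⟨η₃, hη₃, H₃⟩ := Summit.AtomisticToContinuum.HydrodynamicLimit.Theorems.energyConjunct_of_lower
  refine ⟨min η₁ (min η₂ η₃), lt_min hη₁ (lt_min hη₂ hη₃), fun a₀ θ₀ u₀ ha hθ hu ha0 hθ0 => ?_⟩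
  obtain ⟨σ₁, hσ₁, K₁⟩ := H₁ a₀ θ₀ u₀ ha hθ hu ha0 hθ0
  obtain ⟨σ₂, hσ₂, K₂⟩ := H₂ a₀ θ₀ u₀ ha hθ hu ha0 hθ0
  obtain ⟨σ₄, hσ₄, K₄⟩ :=
    Summit.AtomisticToContinuum.HydrodynamicLimit.Theorems.ParityInBandDensity.parityInBand_densityField_of_densityCap
      hD a₀ θ₀ u₀ ha hθ hu ha0 hθ0
  refine ⟨min σ₁ (min σ₂ σ₄), lt_min hσ₁ (lt_min hσ₂ hσ₄), fun σ hσ hσlt T ρ θ u hsol hguard Φ h0 t ht => ?_⟩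
  have hσ1 : σ < σ₁ := hσlt.trans_le (min_le_left _ _)
  have hσ2 : σ < σ₂ := hσlt.trans_le ((min_le_right _ _).trans (min_le_left _ _))
  have hσ4 : σ < σ₄ := hσlt.trans_le ((min_le_right _ _).trans (min_le_right _ _))
  have hg1 : ∀ s ∈ Set.Ico 0 T, ∀ x, ρ s x * σ ^ 3 < η₁ := fun s hs x =>
    (hguard s hs x).trans_le (min_le_left _ _)
  have hg2 : ∀ s ∈ Set.Ico 0 T, ∀ x, ρ s x * σ ^ 3 < η₂ := fun s hs x =>
    (hguard s hs x).trans_le ((min_le_right _ _).trans (min_le_left _ _))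
  have hg3 : ∀ s ∈ Set.Ico 0 T, ∀ x, ρ s x * σ ^ 3 < η₃ := fun s hs x =>
    (hguard s hs x).trans_le ((min_le_right _ _).trans (min_le_right _ _))
  have hDen := K₄ σ hσ hσ4 T ρ θ u hsol Φ h0 t ht
  have hMo := K₁ σ hσ hσ1 T ρ θ u hsol hg1 Φ h0 t ht
  have hLow := K₂ σ hσ hσ2 T ρ θ u hsol hg2 Φ h0 t ht
  have hEner := H₃ σ T a₀ θ₀ u₀ ρ θ u hσ hsol hg3 Φ h0 t ht hLow
  intro χ hχ δ hδ
  exact ⟨hDen χ hχ δ hδ, hMo χ hχ δ hδ, hEner χ hχ δ hδ⟩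

end Summit.AtomisticToContinuum.HydrodynamicLimit.Cruxes.ParityBandClosure.SplitMctaEntropyFloor

end
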